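import Summits.KontsevichZagierPeriods.KontsevichZagierPeriods.Theorems.K2SymbolChainsJensenIsScissorsToolkit

/-!
# Jensen is scissors — toolkit III: substitutions along the last coordinate

Support file for item stmt-KontsevichZagierPeriods-5204 (`JensenIsScissors`, route
KontsevichZagierPeriods/K2SymbolChains). A map of `ℝᵐ⁺¹` of the shape
`Φ z = (init z, F z)` — a substitution `u' = F (b, u)` in the LAST coordinate, fibrewise over the
base point `b = init z` — is a datum of Kontsevich–Zagier's rule 2) on an open band
`D = {(b, u) | b ∈ B, p b < u < q b}` as soon as `F` is `ℚ`-semialgebraic on `D`, differentiable at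
the points of `D`, and on each closed fibre `[p b, q b]` continuous and strictly increasing: `Φ` is
then injective on `D`, its image is the band `{(b, u') | b ∈ B, F (b, p b) < u' < F (b, q b)}`
(intermediate value theorem), and `det Φ' = ∂F/∂u` (`LinearMap.det_of_snoc_init`, the derivative
being block lower-triangular). We record the rule-2) data (`lastCoord_covData`), the resulting
membership `[r] − [r'] ∈ S` for any subgroup `S` containing the scissors moves, and the existence
of the image / preimage representation. The fibrewise DILATION `u' = K (b) · u` (`K > 0`
differentiable on an open set containing the base) is the instance used most often below.

[Kontsevich–Zagier 2001, §1.2, rule 2)] [folklore]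
-/

noncomputable section

open MeasureTheory Set
open Literature.NumberTheory.Transcendental Literature.ModelTheory.ExponentialFields

namespace Summit.KontsevichZagierPeriods.K2SymbolChains.JensenIsScissorsProof

open Literature.NumberTheory.Transcendental.KZ

variable {m : ℕ} {S : AddSubgroup FormalRep}

/-! ### Open bands over a base -/

/-- The open band `{(b, u) | b ∈ B, p b < u < q b}` is `ℚ`-semialgebraic for `ℚ`-semialgebraic data
(strict epigraph of `p` ∩ strict hypograph of `q`, graph elimination). [BCR 1998, §2.2] [folklore] -/
theorem isSemialgebraic_oband {B : Set (Fin m → ℝ)} {p q : (Fin m → ℝ) → ℝ}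
    (hp : IsSemialgebraicFunOn ℚ B p) (hq : IsSemialgebraicFunOn ℚ B q) :
    IsSemialgebraic ℚ {z : Fin (m + 1) → ℝ | Fin.init z ∈ B ∧ p (Fin.init z) < z (Fin.last m) ∧
      z (Fin.last m) < q (Fin.init z)} := by
  convert hp.isSemialgebraic_setOf_gt.inter hq.isSemialgebraic_setOf_lt using 1
  ext z
  simp only [mem_setOf_eq, mem_inter_iff]
  tauto

/-- Fibrewise membership in an open band. [folklore] -/
theorem snoc_mem_oband {B : Set (Fin m → ℝ)} {p q : (Fin m → ℝ) → ℝ} {b : Fin m → ℝ} {t : ℝ} :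
    (Fin.snoc b t : Fin (m + 1) → ℝ) ∈ {z : Fin (m + 1) → ℝ | Fin.init z ∈ B ∧
      p (Fin.init z) < z (Fin.last m) ∧ z (Fin.last m) < q (Fin.init z)} ↔ b ∈ B ∧ p b < t ∧ t < q b := by
  simp

/-! ### The rule-2) data of a last-coordinate substitution -/

/-- The derivative of `z ↦ (init z, F z)` built from a derivative `F'` of `F`: the continuous linear
map `w ↦ (init w, F' w)`. [folklore] -/
theorem lastCoordDeriv_apply (F' : (Fin (m + 1) → ℝ) →L[ℝ] ℝ) (w : Fin (m + 1) → ℝ) :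
    (ContinuousLinearMap.pi (Fin.lastCases (motive := fun _ => (Fin (m + 1) → ℝ) →L[ℝ] ℝ) F'
      (fun i => ContinuousLinearMap.proj (Fin.castSucc i))) : (Fin (m + 1) → ℝ) →L[ℝ] (Fin (m + 1) → ℝ)) w =
      Fin.snoc (Fin.init w) (F' w) := by
  funext i
  refine Fin.lastCases ?_ (fun j => ?_) i
  · simp
  · simp [Fin.init]

/-- **Determinant of a last-coordinate substitution**: `det (w ↦ (init w, F' w)) = F' (e_last)`
(block lower-triangular matrix). [folklore] -/
theorem det_lastCoordDeriv (F' : (Fin (m + 1) → ℝ) →L[ℝ] ℝ) :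
    (ContinuousLinearMap.pi (Fin.lastCases (motive := fun _ => (Fin (m + 1) → ℝ) →L[ℝ] ℝ) F'
      (fun i => ContinuousLinearMap.proj (Fin.castSucc i))) :
        (Fin (m + 1) → ℝ) →L[ℝ] (Fin (m + 1) → ℝ)).det = F' (Pi.single (Fin.last m) 1) := by
  -- the linear map `x ↦ snoc x 0`
  let E : (Fin m → ℝ) →ₗ[ℝ] (Fin (m + 1) → ℝ) :=
    LinearMap.pi (Fin.lastCases (motive := fun _ => (Fin m → ℝ) →ₗ[ℝ] ℝ) 0 (fun j => LinearMap.proj j))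
  have hE : ∀ x, E x = Fin.snoc x 0 := by
    intro x
    funext i
    refine Fin.lastCases ?_ (fun j => ?_) i
    · simp [E]
    · simp [E]
  have hdecomp : ∀ w : Fin (m + 1) → ℝ,
      w = Fin.snoc (Fin.init w) 0 + w (Fin.last m) • (Pi.single (Fin.last m) (1 : ℝ)) := by
    intro w
    funext i
    refine Fin.lastCases ?_ (fun j => ?_) i
    · simp
    · simp [Fin.init, (Fin.castSucc_lt_last j).ne]
  have h := LinearMap.det_of_snoc_init
    ((ContinuousLinearMap.pi (Fin.lastCases (motive := fun _ => (Fin (m + 1) → ℝ) →L[ℝ] ℝ) F'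
      (fun i => ContinuousLinearMap.proj (Fin.castSucc i))) :
        (Fin (m + 1) → ℝ) →L[ℝ] (Fin (m + 1) → ℝ)) : (Fin (m + 1) → ℝ) →ₗ[ℝ] (Fin (m + 1) → ℝ))
    LinearMap.id ((F' : (Fin (m + 1) → ℝ) →ₗ[ℝ] ℝ).comp E) (F' (Pi.single (Fin.last m) 1))
    (fun w => by
      rw [ContinuousLinearMap.coe_coe, lastCoordDeriv_apply]
      simp only [LinearMap.id_coe, id_eq, LinearMap.coe_comp, Function.comp_apply, hE]
      congr 1
      conv_lhs => rw [hdecomp w]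
      rw [map_add, map_smul, smul_eq_mul, mul_comm]
      rfl)
  rw [LinearMap.det_id, mul_one] at h
  exact h


/-- **A last-coordinate substitution is a rule-2) datum (basic form).** On a `ℚ`-semialgebraic
`D ⊆ ℝᵐ⁺¹` let `F` be `ℚ`-semialgebraic, differentiable at every point of `D` with derivative `F' z`,
and injective on each fibre `D ∩ {init = b}`. Then `Φ z = (init z, F z)` is a `ℚ`-semialgebraic
injective map on `D` with derivative `w ↦ (init w, F' z w)` within `D`.
[Kontsevich–Zagier 2001, §1.2, rule 2)] [folklore] -/
theorem lastCoord_covData_basic {D : Set (Fin (m + 1) → ℝ)} (hD : IsSemialgebraic ℚ D)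
    {F : (Fin (m + 1) → ℝ) → ℝ} {F' : (Fin (m + 1) → ℝ) → (Fin (m + 1) → ℝ) →L[ℝ] ℝ}
    (hF : IsSemialgebraicFunOn ℚ D F) (hF' : ∀ z ∈ D, HasFDerivAt F (F' z) z)
    (hinj : ∀ z₁ ∈ D, ∀ z₂ ∈ D, Fin.init z₁ = Fin.init z₂ → F z₁ = F z₂ → z₁ = z₂) :
    IsSemialgebraicMapOn ℚ D (fun z => (Fin.snoc (Fin.init z) (F z) : Fin (m + 1) → ℝ)) ∧
      (∀ z ∈ D, HasFDerivWithinAt (fun z => (Fin.snoc (Fin.init z) (F z) : Fin (m + 1) → ℝ))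
          (ContinuousLinearMap.pi (Fin.lastCases (motive := fun _ => (Fin (m + 1) → ℝ) →L[ℝ] ℝ)
            (F' z) (fun i => ContinuousLinearMap.proj (Fin.castSucc i)))) D z) ∧
      InjOn (fun z => (Fin.snoc (Fin.init z) (F z) : Fin (m + 1) → ℝ)) D := by
  refine ⟨?_, ?_, ?_⟩
  · -- semialgebraic map
    refine (isSemialgebraicMapOn_iff_forall_holds hD).mpr fun i => ?_
    refine Fin.lastCases ?_ (fun j => ?_) i
    · exact hF.congr fun z _ => by simp
    · exact (isSemialgebraicFunOn_apply hD (Fin.castSucc j)).congr fun z _ => by simp [Fin.init]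
  · -- derivative
    intro z hz
    refine HasFDerivAt.hasFDerivWithinAt ?_
    rw [hasFDerivAt_pi']
    intro i
    refine Fin.lastCases ?_ (fun j => ?_) i
    · have hfun : (fun x : Fin (m + 1) → ℝ =>
          (Fin.snoc (Fin.init x) (F x) : Fin (m + 1) → ℝ) (Fin.last m)) = F := by
        funext x; simp
      rw [hfun]
      refine (hF' z hz).congr_fderiv (ContinuousLinearMap.ext fun w => ?_)
      simp
    · have hfun : (fun x : Fin (m + 1) → ℝ =>
          (Fin.snoc (Fin.init x) (F x) : Fin (m + 1) → ℝ) (Fin.castSucc j)) =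
          fun x => x (Fin.castSucc j) := by
        funext x; simp [Fin.init]
      rw [hfun]
      refine (hasFDerivAt_apply (Fin.castSucc j) z).congr_fderiv
        (ContinuousLinearMap.ext fun w => ?_)
      simp
  · -- injectivity
    intro z₁ hz₁ z₂ hz₂ h
    have hb : Fin.init z₁ = Fin.init z₂ := by simpa using congrArg Fin.init h
    have hF12 : F z₁ = F z₂ := by simpa using congrFun h (Fin.last m)
    exact hinj z₁ hz₁ z₂ hz₂ hb hF12

/-- **A last-coordinate substitution is a rule-2) datum.** On the open band
`D = {(b, u) | b ∈ B, p b < u < q b}` (`p ≤ q`, all data `ℚ`-semialgebraic) let `F` be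
`ℚ`-semialgebraic, differentiable at every point of `D` with derivative `F' z`, and on each closed
fibre `u ∈ [p b, q b]` continuous and strictly increasing. Then `Φ z = (init z, F z)` is a
`ℚ`-semialgebraic injective map on `D` with derivative `w ↦ (init w, F' z w)` and image the band
`{(b, u') | b ∈ B, F (b, p b) < u' < F (b, q b)}`. [Kontsevich–Zagier 2001, §1.2, rule 2)] [folklore] -/
theorem lastCoord_covData {B : Set (Fin m → ℝ)} {p q : (Fin m → ℝ) → ℝ}
    {F : (Fin (m + 1) → ℝ) → ℝ} {F' : (Fin (m + 1) → ℝ) → (Fin (m + 1) → ℝ) →L[ℝ] ℝ}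
    (hp : IsSemialgebraicFunOn ℚ B p) (hq : IsSemialgebraicFunOn ℚ B q)
    (hpq : ∀ b ∈ B, p b ≤ q b)
    (hF : IsSemialgebraicFunOn ℚ {z : Fin (m + 1) → ℝ | Fin.init z ∈ B ∧ p (Fin.init z) < z (Fin.last m) ∧
      z (Fin.last m) < q (Fin.init z)} F)
    (hF' : ∀ z ∈ {z : Fin (m + 1) → ℝ | Fin.init z ∈ B ∧ p (Fin.init z) < z (Fin.last m) ∧
      z (Fin.last m) < q (Fin.init z)}, HasFDerivAt F (F' z) z)
    (hcont : ∀ b ∈ B, ContinuousOn (fun t : ℝ => F (Fin.snoc b t)) (Icc (p b) (q b)))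
    (hmono : ∀ b ∈ B, StrictMonoOn (fun t : ℝ => F (Fin.snoc b t)) (Icc (p b) (q b))) :
    IsSemialgebraicMapOn ℚ {z : Fin (m + 1) → ℝ | Fin.init z ∈ B ∧ p (Fin.init z) < z (Fin.last m) ∧
        z (Fin.last m) < q (Fin.init z)} (fun z => Fin.snoc (Fin.init z) (F z)) ∧
      (∀ z ∈ {z : Fin (m + 1) → ℝ | Fin.init z ∈ B ∧ p (Fin.init z) < z (Fin.last m) ∧
          z (Fin.last m) < q (Fin.init z)},
        HasFDerivWithinAt (fun z => (Fin.snoc (Fin.init z) (F z) : Fin (m + 1) → ℝ))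
          (ContinuousLinearMap.pi (Fin.lastCases (motive := fun _ => (Fin (m + 1) → ℝ) →L[ℝ] ℝ)
            (F' z) (fun i => ContinuousLinearMap.proj (Fin.castSucc i))))
          {z : Fin (m + 1) → ℝ | Fin.init z ∈ B ∧ p (Fin.init z) < z (Fin.last m) ∧
            z (Fin.last m) < q (Fin.init z)} z) ∧
      InjOn (fun z => (Fin.snoc (Fin.init z) (F z) : Fin (m + 1) → ℝ))
        {z : Fin (m + 1) → ℝ | Fin.init z ∈ B ∧ p (Fin.init z) < z (Fin.last m) ∧
          z (Fin.last m) < q (Fin.init z)} ∧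
      (fun z => (Fin.snoc (Fin.init z) (F z) : Fin (m + 1) → ℝ)) ''
          {z : Fin (m + 1) → ℝ | Fin.init z ∈ B ∧ p (Fin.init z) < z (Fin.last m) ∧
            z (Fin.last m) < q (Fin.init z)} =
        {z : Fin (m + 1) → ℝ | Fin.init z ∈ B ∧ F (Fin.snoc (Fin.init z) (p (Fin.init z))) < z (Fin.last m) ∧
          z (Fin.last m) < F (Fin.snoc (Fin.init z) (q (Fin.init z)))} := by
  set D := {z : Fin (m + 1) → ℝ | Fin.init z ∈ B ∧ p (Fin.init z) < z (Fin.last m) ∧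
      z (Fin.last m) < q (Fin.init z)} with hD
  have hDs : IsSemialgebraic ℚ D := isSemialgebraic_oband hp hq
  have hfinj : ∀ z₁ ∈ D, ∀ z₂ ∈ D, Fin.init z₁ = Fin.init z₂ → F z₁ = F z₂ → z₁ = z₂ := by
    intro z₁ hz₁ z₂ hz₂ hb hF12
    rw [hD] at hz₁ hz₂
    have hmem₁ : z₁ (Fin.last m) ∈ Icc (p (Fin.init z₁)) (q (Fin.init z₁)) :=
      ⟨hz₁.2.1.le, hz₁.2.2.le⟩
    have hmem₂ : z₂ (Fin.last m) ∈ Icc (p (Fin.init z₁)) (q (Fin.init z₁)) := by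
      rw [hb]; exact ⟨hz₂.2.1.le, hz₂.2.2.le⟩
    have h1 : (fun t : ℝ => F (Fin.snoc (Fin.init z₁) t)) (z₁ (Fin.last m)) =
        (fun t : ℝ => F (Fin.snoc (Fin.init z₁) t)) (z₂ (Fin.last m)) := by
      simp only [Fin.snoc_init_self]
      rw [hF12, hb, Fin.snoc_init_self]
    have ht : z₁ (Fin.last m) = z₂ (Fin.last m) := (hmono _ hz₁.1).injOn hmem₁ hmem₂ h1
    rw [← Fin.snoc_init_self z₁, ← Fin.snoc_init_self z₂, hb, ht]
  obtain ⟨hmap, hder, hinj⟩ := lastCoord_covData_basic hDs hF hF' hfinj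
  refine ⟨hmap, hder, hinj, ?_⟩
  · -- image
    ext w
    simp only [mem_image, mem_setOf_eq]
    constructor
    · rintro ⟨z, hz, rfl⟩
      rw [hD] at hz
      simp only [mem_setOf_eq] at hz
      obtain ⟨hbB, h1, h2⟩ := hz
      have hmn := hmono _ hbB
      simp only [Fin.init_snoc, Fin.snoc_last]
      refine ⟨hbB, ?_, ?_⟩
      · have := hmn ⟨le_rfl, (hpq _ hbB)⟩ ⟨h1.le, h2.le⟩ h1
        simpa using this
      · have := hmn ⟨h1.le, h2.le⟩ ⟨hpq _ hbB, le_rfl⟩ h2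
        simpa using this
    · rintro ⟨hbB, h1, h2⟩
      have hle := hpq _ hbB
      obtain ⟨t, ht, hFt⟩ := intermediate_value_Icc hle (hcont _ hbB) ⟨h1.le, h2.le⟩
      have htp : t ≠ p (Fin.init w) := by
        rintro rfl; simp only at hFt; exact (lt_irrefl _) (hFt ▸ h1)
      have htq : t ≠ q (Fin.init w) := by
        rintro rfl; simp only at hFt; exact (lt_irrefl _) (hFt ▸ h2)
      refine ⟨Fin.snoc (Fin.init w) t, ?_, ?_⟩
      · rw [hD]
        simp only [mem_setOf_eq, Fin.init_snoc, Fin.snoc_last]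
        exact ⟨hbB, lt_of_le_of_ne ht.1 (Ne.symm htp), lt_of_le_of_ne ht.2 htq⟩
      · simp only [Fin.init_snoc] at hFt ⊢
        rw [hFt, Fin.snoc_init_self]

/-- **Last-coordinate substitution inside `S`.** Under the hypotheses of `lastCoord_covData`, if
`r` has domain the band `D` and `r'` the image band, and
`r.integrand z = r'.integrand (init z, F z) · |F' z (e_last)|` on `D`, then `[r] − [r'] ∈ S`.
[Kontsevich–Zagier 2001, §1.2, rule 2)] [folklore] -/
theorem of_sub_of_mem_lastCoord (hS : domainAddRel ∪ integrandAddRel ∪ changeOfVariablesRel ⊆ S)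
    {B : Set (Fin m → ℝ)} {p q : (Fin m → ℝ) → ℝ}
    {F : (Fin (m + 1) → ℝ) → ℝ} {F' : (Fin (m + 1) → ℝ) → (Fin (m + 1) → ℝ) →L[ℝ] ℝ}
    (hp : IsSemialgebraicFunOn ℚ B p) (hq : IsSemialgebraicFunOn ℚ B q)
    (hpq : ∀ b ∈ B, p b ≤ q b) (r r' : IntegralRep (m + 1))
    (hr : r.domain = {z : Fin (m + 1) → ℝ | Fin.init z ∈ B ∧ p (Fin.init z) < z (Fin.last m) ∧
      z (Fin.last m) < q (Fin.init z)})
    (hF : IsSemialgebraicFunOn ℚ r.domain F) (hF' : ∀ z ∈ r.domain, HasFDerivAt F (F' z) z)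
    (hcont : ∀ b ∈ B, ContinuousOn (fun t : ℝ => F (Fin.snoc b t)) (Icc (p b) (q b)))
    (hmono : ∀ b ∈ B, StrictMonoOn (fun t : ℝ => F (Fin.snoc b t)) (Icc (p b) (q b)))
    (hr' : r'.domain = {z : Fin (m + 1) → ℝ | Fin.init z ∈ B ∧
      F (Fin.snoc (Fin.init z) (p (Fin.init z))) < z (Fin.last m) ∧
        z (Fin.last m) < F (Fin.snoc (Fin.init z) (q (Fin.init z)))})
    (hint : ∀ z ∈ r.domain, r.integrand z =
      r'.integrand (Fin.snoc (Fin.init z) (F z)) * |F' z (Pi.single (Fin.last m) 1)|) :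
    of r - of r' ∈ S := by
  rw [hr] at hF hF'
  obtain ⟨h1, h2, h3, h4⟩ := lastCoord_covData hp hq hpq hF hF' hcont hmono
  rw [← hr] at h1 h2 h3 h4
  refine mem_of_mem_changeOfVariablesRel hS ⟨m + 1, r, r', _, _, h1, h2, h3, ?_, fun z hz => ?_, rfl⟩
  · rw [h4, hr']
  · rw [hint z hz, det_lastCoordDeriv]

/-- **The image of a band representation under a last-coordinate substitution exists** (and differs
from it by an element of `S`): given `r` on the band `D` and a `ℚ`-semialgebraic `f'` on the image
band with `r.integrand z = f' (init z, F z) · |F' z (e_last)|` on `D`.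
[Kontsevich–Zagier 2001, §1.2, rule 2)] [folklore] -/
theorem exists_image_lastCoord (hS : domainAddRel ∪ integrandAddRel ∪ changeOfVariablesRel ⊆ S)
    {B : Set (Fin m → ℝ)} {p q : (Fin m → ℝ) → ℝ}
    {F : (Fin (m + 1) → ℝ) → ℝ} {F' : (Fin (m + 1) → ℝ) → (Fin (m + 1) → ℝ) →L[ℝ] ℝ}
    (hp : IsSemialgebraicFunOn ℚ B p) (hq : IsSemialgebraicFunOn ℚ B q)
    (hpq : ∀ b ∈ B, p b ≤ q b) (r : IntegralRep (m + 1))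
    (hr : r.domain = {z : Fin (m + 1) → ℝ | Fin.init z ∈ B ∧ p (Fin.init z) < z (Fin.last m) ∧
      z (Fin.last m) < q (Fin.init z)})
    (hF : IsSemialgebraicFunOn ℚ r.domain F) (hF' : ∀ z ∈ r.domain, HasFDerivAt F (F' z) z)
    (hcont : ∀ b ∈ B, ContinuousOn (fun t : ℝ => F (Fin.snoc b t)) (Icc (p b) (q b)))
    (hmono : ∀ b ∈ B, StrictMonoOn (fun t : ℝ => F (Fin.snoc b t)) (Icc (p b) (q b)))
    {f' : (Fin (m + 1) → ℝ) → ℝ}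
    (hf' : IsSemialgebraicFunOn ℚ {z : Fin (m + 1) → ℝ | Fin.init z ∈ B ∧
      F (Fin.snoc (Fin.init z) (p (Fin.init z))) < z (Fin.last m) ∧
        z (Fin.last m) < F (Fin.snoc (Fin.init z) (q (Fin.init z)))} f')
    (hint : ∀ z ∈ r.domain, r.integrand z =
      f' (Fin.snoc (Fin.init z) (F z)) * |F' z (Pi.single (Fin.last m) 1)|) :
    ∃ r' : IntegralRep (m + 1), r'.domain = {z : Fin (m + 1) → ℝ | Fin.init z ∈ B ∧
      F (Fin.snoc (Fin.init z) (p (Fin.init z))) < z (Fin.last m) ∧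
        z (Fin.last m) < F (Fin.snoc (Fin.init z) (q (Fin.init z)))} ∧ r'.integrand = f' ∧
      of r - of r' ∈ S := by
  rw [hr] at hF hF'
  obtain ⟨h1, h2, h3, h4⟩ := lastCoord_covData hp hq hpq hF hF' hcont hmono
  rw [← hr] at h1 h2 h3 h4
  rw [← h4] at hf'
  obtain ⟨r', hd, hi, hrel⟩ := exists_image_rep r h1 h2 h3 hf' (fun z hz => by
    rw [hint z hz, det_lastCoordDeriv])
  exact ⟨r', hd.trans h4, hi, mem_of_mem_changeOfVariablesRel hS hrel⟩

/-- **The preimage of a band representation under a last-coordinate substitution exists** (and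
differs from it by an element of `S`): given `r'` on the image band and a `ℚ`-semialgebraic `f` on
`D` with `f z = r'.integrand (init z, F z) · |F' z (e_last)|`. [Kontsevich–Zagier 2001, §1.2,
rule 2)] [folklore] -/
theorem exists_preimage_lastCoord (hS : domainAddRel ∪ integrandAddRel ∪ changeOfVariablesRel ⊆ S)
    {B : Set (Fin m → ℝ)} {p q : (Fin m → ℝ) → ℝ}
    {F : (Fin (m + 1) → ℝ) → ℝ} {F' : (Fin (m + 1) → ℝ) → (Fin (m + 1) → ℝ) →L[ℝ] ℝ}
    (hp : IsSemialgebraicFunOn ℚ B p) (hq : IsSemialgebraicFunOn ℚ B q)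
    (hpq : ∀ b ∈ B, p b ≤ q b) (r' : IntegralRep (m + 1))
    (hF : IsSemialgebraicFunOn ℚ {z : Fin (m + 1) → ℝ | Fin.init z ∈ B ∧ p (Fin.init z) < z (Fin.last m) ∧
      z (Fin.last m) < q (Fin.init z)} F)
    (hF' : ∀ z ∈ {z : Fin (m + 1) → ℝ | Fin.init z ∈ B ∧ p (Fin.init z) < z (Fin.last m) ∧
      z (Fin.last m) < q (Fin.init z)}, HasFDerivAt F (F' z) z)
    (hcont : ∀ b ∈ B, ContinuousOn (fun t : ℝ => F (Fin.snoc b t)) (Icc (p b) (q b)))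
    (hmono : ∀ b ∈ B, StrictMonoOn (fun t : ℝ => F (Fin.snoc b t)) (Icc (p b) (q b)))
    (hr' : r'.domain = {z : Fin (m + 1) → ℝ | Fin.init z ∈ B ∧
      F (Fin.snoc (Fin.init z) (p (Fin.init z))) < z (Fin.last m) ∧
        z (Fin.last m) < F (Fin.snoc (Fin.init z) (q (Fin.init z)))})
    {f : (Fin (m + 1) → ℝ) → ℝ}
    (hf : IsSemialgebraicFunOn ℚ {z : Fin (m + 1) → ℝ | Fin.init z ∈ B ∧ p (Fin.init z) < z (Fin.last m) ∧
      z (Fin.last m) < q (Fin.init z)} f)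
    (hint : ∀ z ∈ {z : Fin (m + 1) → ℝ | Fin.init z ∈ B ∧ p (Fin.init z) < z (Fin.last m) ∧
      z (Fin.last m) < q (Fin.init z)}, f z =
        r'.integrand (Fin.snoc (Fin.init z) (F z)) * |F' z (Pi.single (Fin.last m) 1)|) :
    ∃ r : IntegralRep (m + 1), r.domain = {z : Fin (m + 1) → ℝ | Fin.init z ∈ B ∧
      p (Fin.init z) < z (Fin.last m) ∧ z (Fin.last m) < q (Fin.init z)} ∧ r.integrand = f ∧
      of r - of r' ∈ S := by
  obtain ⟨h1, h2, h3, h4⟩ := lastCoord_covData hp hq hpq hF hF' hcont hmono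
  obtain ⟨r, hd, hi, hrel⟩ := exists_preimage_rep r' (isSemialgebraic_oband hp hq) h1 h2 h3
    (h4.trans hr'.symm) hf (fun z hz => by rw [hint z hz, det_lastCoordDeriv])
  exact ⟨r, hd, hi, mem_of_mem_changeOfVariablesRel hS hrel⟩

end Summit.KontsevichZagierPeriods.K2SymbolChains.JensenIsScissorsProof
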